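import Literature.AlgebraicTopology.SingularHomology.LocallyFlatCriticalDegree
import Literature.AlgebraicTopology.SingularHomology.RelativeHomotopyInvariance
import Literature.AlgebraicTopology.SingularHomology.StratumLocalHomology
import Literature.AlgebraicTopology.SingularHomology.LocalHomologyIso
import HarnessLib

/-!
# The class pulled back along a map of pairs which is a coordinate in one chart, I: the model ball

First half of `SingularHomology/LocallyFlatPairMapLine` (the topological content of the
Lelong–Poincaré formula "`[D] = [f⁻¹(0)]` for `f` vanishing to order one along `D`", C. Voisin,
*Hodge Theory and Complex Algebraic Geometry I* (2002), §11.1.2 and proof of Thm. 11.33, in the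
support calculus and for topological straightenings). The model computations on the ball
`B = B((0, y₀), r) ⊆ ℂ × K₀` with its flat piece `L = {p | p.1 = 0}` (A. Hatcher, *Algebraic
Topology* (2002), §2.1 Prop. 2.19, Thm. 2.20, §3.3 p. 231):

* `exists_homeomorph_ball_prod` — `B ≅ B_ℂ(0,r) × B_{K₀}(y₀,r)` preserving the first coordinate,
  `L` corresponding to `{0} × B_{K₀}(y₀,r)`;
* `bijective_map_fst_ball` — **the first coordinate `(B, B ∖ L) → (ℂ, ℂ ∖ 0)` induces bijections on
  relative homology** (product with a contractible ball, the tree's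
  `localHomologyOfSet.isIso_map_fst_prod`, and excision `H(B_ℂ(0,r) | 0) ≅ H(ℂ | 0)`);
* `nonempty_localHomology_complex_zero_iso`, `exists_map_fst_ball_ne_zero` — `H₂(ℂ | 0; R) ≅ R`, so
  for `R ≠ 0` some class of `H₂(B | L; R)` has non-zero first coordinate;
* `map_mul_fst_ball_eq` — **a RESCALED first coordinate `p ↦ C(p) · p.1` (`C` continuous and nowhere
  zero) induces the same map as `p ↦ p.1`**: contract the ball inside the argument of `C` (a homotopy
  of pair maps since `C ≠ 0`), then join `C(centre)` to `1` inside `ℂ ∖ 0` (the tree's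
  `relativeSingularHomology.map_eq_of_homotopic_holds`).

Everything is proved; no definitions, no named facts.

## References

* [VoisinHodgeI2002] C. Voisin, Hodge Theory and Complex Algebraic Geometry I, CUP 2002, §11.1.2,
  Thm. 11.33 (proof).
* [HatcherAT2002] A. Hatcher, Algebraic Topology, CUP 2002, §2.1 Prop. 2.19, Thm. 2.20, §3.3 p. 231.
-/

noncomputable section

open CategoryTheory Limits Set TopologicalSpace Metric

universe u v

namespace Literature.AlgebraicTopology.SingularHomology

variable (R : Type v) [CommRing R] (M : Type v) [AddCommGroup M] [Module R M]

/-! ### The model ball: first coordinate, rescaling, and a non-zero class -/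

section PairMapModel

variable {K₀ : Type} [NormedAddCommGroup K₀] [NormedSpace ℝ K₀]

omit [NormedSpace ℝ K₀] in
/-- The model ball `B((0, y₀), r) ⊆ ℂ × K₀` is homeomorphic to `B_ℂ(0, r) × B_{K₀}(y₀, r)`, the trace
of the flat piece `{p | p.1 = 0}` corresponding to `{0} × B_{K₀}(y₀, r)`, and the first coordinate
being preserved. [folklore] -/
theorem exists_homeomorph_ball_prod (y₀ : K₀) {r : ℝ} (hr : 0 < r) :
    ∃ η : ↥(ball ((0 : ℂ), y₀) r) ≃ₜ ↥(ball (0 : ℂ) r) × ↥(ball y₀ r),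
      (∀ p, ((η p).1 : ℂ) = p.1.1) ∧
        η ⁻¹' (({⟨0, mem_ball_self hr⟩} : Set ↥(ball (0 : ℂ) r)) ×ˢ (univ : Set ↥(ball y₀ r)))ᶜ =
          (Subtype.val ⁻¹' {p : ℂ × K₀ | p.1 = 0} : Set ↥(ball ((0 : ℂ), y₀) r))ᶜ := by
  have hmem : ∀ p : ↥(ball ((0 : ℂ), y₀) r), p.1.1 ∈ ball (0 : ℂ) r ∧ p.1.2 ∈ ball y₀ r := fun p ↦ by
    have h : p.1 ∈ ball (0 : ℂ) r ×ˢ ball y₀ r := by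
      rw [ball_prod_same]
      exact p.2
    exact ⟨h.1, h.2⟩
  have hmem' : ∀ q : ↥(ball (0 : ℂ) r) × ↥(ball y₀ r), ((q.1 : ℂ), (q.2 : K₀)) ∈ ball ((0 : ℂ), y₀) r :=
    fun q ↦ by rw [← ball_prod_same]; exact ⟨q.1.2, q.2.2⟩
  refine ⟨{ toFun := fun p ↦ (⟨p.1.1, (hmem p).1⟩, ⟨p.1.2, (hmem p).2⟩)
            invFun := fun q ↦ ⟨((q.1 : ℂ), (q.2 : K₀)), hmem' q⟩
            left_inv := fun p ↦ rfl
            right_inv := fun q ↦ rfl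
            continuous_toFun := by fun_prop
            continuous_invFun := by fun_prop }, fun p ↦ rfl, ?_⟩
  ext p
  simp only [mem_preimage, mem_compl_iff, mem_prod, mem_singleton_iff, mem_univ, and_true,
    mem_setOf_eq]
  exact not_congr ⟨fun h ↦ congrArg Subtype.val h, fun h ↦ Subtype.ext h⟩

/-- **The first coordinate `(B((0,y₀),r), B ∖ L) → (ℂ, ℂ ∖ 0)` induces bijections on relative
homology** (product with a contractible ball, `localHomologyOfSet.isIso_map_fst_prod`, and excision
`H(B_ℂ(0,r) | 0) ≅ H(ℂ | 0)`, `localHomology.openSubsetIso`). [cite: HatcherAT2002, §2.1 Prop. 2.19 and Thm. 2.20] -/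
theorem bijective_map_fst_ball (y₀ : K₀) {r : ℝ} (hr : 0 < r)
    (hpr : MapsTo (fun p : ↥(ball ((0 : ℂ), y₀) r) ↦ p.1.1)
      (Subtype.val ⁻¹' {p : ℂ × K₀ | p.1 = 0} : Set ↥(ball ((0 : ℂ), y₀) r))ᶜ ({0}ᶜ : Set ℂ)) (n : ℕ) :
    Function.Bijective (relativeSingularHomology.map R M
      (⟨fun p : ↥(ball ((0 : ℂ), y₀) r) ↦ p.1.1, by fun_prop⟩ : C(↥(ball ((0 : ℂ), y₀) r), ℂ)) hpr n) := by
  obtain ⟨η, hη, hηpre⟩ := exists_homeomorph_ball_prod (K₀ := K₀) y₀ hr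
  haveI : ContractibleSpace ↥(ball y₀ r) := (convex_ball y₀ r).contractibleSpace ⟨y₀, mem_ball_self hr⟩
  have h0 : (0 : ℂ) ∈ ball (0 : ℂ) r := mem_ball_self hr
  -- the three factors
  have hη' : MapsTo (η : C(↥(ball ((0 : ℂ), y₀) r), ↥(ball (0 : ℂ) r) × ↥(ball y₀ r)))
      (Subtype.val ⁻¹' {p : ℂ × K₀ | p.1 = 0} : Set ↥(ball ((0 : ℂ), y₀) r))ᶜ
      (({⟨0, h0⟩} : Set ↥(ball (0 : ℂ) r)) ×ˢ (univ : Set ↥(ball y₀ r)))ᶜ := by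
    intro p hp
    rw [← hηpre] at hp
    exact hp
  have h₁ := relativeSingularHomology.bijective_map_homeomorph R M η hηpre hη' n
  haveI := localHomologyOfSet.isIso_map_fst_prod R M (B := ↥(ball y₀ r))
    ({⟨0, h0⟩} : Set ↥(ball (0 : ℂ) r)) n
  -- the composite is the first coordinate
  haveI i₁ : IsIso (relativeSingularHomology.map R M _ hη' n) :=
    (LinearEquiv.ofBijective _ h₁).toModuleIso.isIso_hom
  haveI i₃ := localHomology.isIso_map_subsetIncl_of_isOpen R M (isOpen_ball : IsOpen (ball (0 : ℂ) r)) h0 n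
  have hfst := mapsTo_fst_compl_prod (B := ↥(ball y₀ r)) ({⟨0, h0⟩} : Set ↥(ball (0 : ℂ) r))
  have hincl := localHomology.mapsTo_subsetIncl_compl (X := ℂ) h0
  have key := LCube.relMap_congr R M
    (f := (⟨fun p : ↥(ball ((0 : ℂ), y₀) r) ↦ p.1.1, by fun_prop⟩ : C(↥(ball ((0 : ℂ), y₀) r), ℂ)))
    (g := ((subsetIncl (ball (0 : ℂ) r)).comp
      (ContinuousMap.fst : C(↥(ball (0 : ℂ) r) × ↥(ball y₀ r), ↥(ball (0 : ℂ) r)))).comp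
      (η : C(↥(ball ((0 : ℂ), y₀) r), ↥(ball (0 : ℂ) r) × ↥(ball y₀ r))))
    (ContinuousMap.ext fun p ↦ (hη p).symm) hpr ((hincl.comp hfst).comp hη') n
  rw [key, relativeSingularHomology.map_comp R M _ _ hη' (hincl.comp hfst) n,
    relativeSingularHomology.map_comp R M _ _ hfst hincl n]
  exact ConcreteCategory.bijective_of_isIso (_ ≫ _ ≫ _)

/-- `H_2(ℂ | 0; R) ≅ R`: the local homology of the plane at a point (Hatcher 2002, §3.3 p. 231; the
tree's `localHomologyRVecIso` transported along `ℂ ≅ ℝ²`). [cite: HatcherAT2002, §3.3 p. 231] -/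
theorem nonempty_localHomology_complex_zero_iso :
    Nonempty (localHomology R M ℂ 0 2 ≅ ModuleCat.of R M) := by
  let L : ℂ ≃L[ℝ] RVec 2 := ContinuousLinearEquiv.ofFinrankEq (by simp)
  exact ⟨localHomology.mapIso R M L.toHomeomorph 0 2 ≪≫ localHomologyRVecIso R M 0 _⟩

/-- **The model group has a class which is non-zero in `H_2(ℂ | 0)`**: some class of
`H_2(B((0,y₀),r) | L; R)` has non-zero image under the first coordinate, as soon as `R ≠ 0`.
[cite: HatcherAT2002, §3.3 p. 231] -/
theorem exists_map_fst_ball_ne_zero [Nontrivial R] (y₀ : K₀) {r : ℝ} (hr : 0 < r)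
    (hpr : MapsTo (fun p : ↥(ball ((0 : ℂ), y₀) r) ↦ p.1.1)
      (Subtype.val ⁻¹' {p : ℂ × K₀ | p.1 = 0} : Set ↥(ball ((0 : ℂ), y₀) r))ᶜ ({0}ᶜ : Set ℂ)) :
    ∃ x : localHomologyOfSet R R ↥(ball ((0 : ℂ), y₀) r) (Subtype.val ⁻¹' {p : ℂ × K₀ | p.1 = 0}) 2,
      relativeSingularHomology.map R R
        (⟨fun p : ↥(ball ((0 : ℂ), y₀) r) ↦ p.1.1, by fun_prop⟩ : C(↥(ball ((0 : ℂ), y₀) r), ℂ)) hpr 2 x ≠ 0 := by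
  obtain ⟨e⟩ := nonempty_localHomology_complex_zero_iso R R
  have hne : (e.inv (1 : R)) ≠ 0 := by
    intro h
    have := congrArg e.hom h
    rw [← ModuleCat.comp_apply, e.inv_hom_id, ModuleCat.id_apply, map_zero] at this
    exact one_ne_zero this
  obtain ⟨x, hx⟩ := (bijective_map_fst_ball R R y₀ hr hpr 2).2 (e.inv 1)
  exact ⟨x, by rw [hx]; exact hne⟩

/-- **A rescaled first coordinate is homotopic, as a map of pairs, to the first coordinate.** On the
ball `B = B((0, y₀), r)` of `ℂ × K₀` let `C : B → ℂ` be continuous and nowhere zero; then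
`p ↦ C(p) · p.1` and `p ↦ p.1`, both maps of pairs `(B, B ∖ L) → (ℂ, ℂ ∖ 0)`, induce the same map on
relative homology: contract `B` to its centre inside the argument of `C` (a homotopy of pair maps
since `C ≠ 0`), then join `C(centre)` to `1` inside `ℂ ∖ 0`. [cite: HatcherAT2002, §2.1 Prop. 2.19] -/
theorem map_mul_fst_ball_eq (y₀ : K₀) {r : ℝ} (hr : 0 < r) (C : C(↥(ball ((0 : ℂ), y₀) r), ℂ))
    (hC : ∀ p, C p ≠ 0)
    (hm : MapsTo (fun p : ↥(ball ((0 : ℂ), y₀) r) ↦ C p * p.1.1)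
      (Subtype.val ⁻¹' {p : ℂ × K₀ | p.1 = 0} : Set ↥(ball ((0 : ℂ), y₀) r))ᶜ ({0}ᶜ : Set ℂ))
    (hpr : MapsTo (fun p : ↥(ball ((0 : ℂ), y₀) r) ↦ p.1.1)
      (Subtype.val ⁻¹' {p : ℂ × K₀ | p.1 = 0} : Set ↥(ball ((0 : ℂ), y₀) r))ᶜ ({0}ᶜ : Set ℂ)) (n : ℕ) :
    relativeSingularHomology.map R M
        (⟨fun p ↦ C p * p.1.1, by fun_prop⟩ : C(↥(ball ((0 : ℂ), y₀) r), ℂ)) hm n =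
      relativeSingularHomology.map R M
        (⟨fun p : ↥(ball ((0 : ℂ), y₀) r) ↦ p.1.1, by fun_prop⟩ : C(↥(ball ((0 : ℂ), y₀) r), ℂ)) hpr n := by
  set c₀ : ℂ := C ⟨((0 : ℂ), y₀), mem_ball_self hr⟩ with hc₀def
  have hc₀ : c₀ ≠ 0 := hC _
  -- the intermediate map `p ↦ c₀ · p.1`
  have hm₁ : MapsTo (fun p : ↥(ball ((0 : ℂ), y₀) r) ↦ c₀ * p.1.1)
      (Subtype.val ⁻¹' {p : ℂ × K₀ | p.1 = 0} : Set ↥(ball ((0 : ℂ), y₀) r))ᶜ ({0}ᶜ : Set ℂ) :=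
    fun p hp h0 ↦ hp (by
      simp only [mem_singleton_iff, mul_eq_zero, hc₀, false_or] at h0
      exact h0)
  -- first homotopy: contract the ball inside the argument of `C`
  have hconv : Convex ℝ (ball ((0 : ℂ), y₀) r) := convex_ball _ _
  have hγ : ∀ (t : unitInterval) (p : ↥(ball ((0 : ℂ), y₀) r)),
      (1 - (t : ℝ)) • p.1 + (t : ℝ) • ((0 : ℂ), y₀) ∈ ball ((0 : ℂ), y₀) r := fun t p ↦
    hconv p.2 (mem_ball_self hr) (by linarith [t.2.2]) t.2.1 (by ring)
  let γ : C(unitInterval × ↥(ball ((0 : ℂ), y₀) r), ↥(ball ((0 : ℂ), y₀) r)) :=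
    ⟨fun tp ↦ ⟨(1 - (tp.1 : ℝ)) • tp.2.1 + (tp.1 : ℝ) • ((0 : ℂ), y₀), hγ tp.1 tp.2⟩,
      Continuous.subtype_mk (by fun_prop) _⟩
  have hγ0 : ∀ p, γ (0, p) = p := fun p ↦ Subtype.ext (by simp [γ])
  have hγ1 : ∀ p, γ (1, p) = ⟨((0 : ℂ), y₀), mem_ball_self hr⟩ := fun p ↦ Subtype.ext (by simp [γ])
  let H₁ : ContinuousMap.Homotopy
      (⟨fun p ↦ C p * p.1.1, by fun_prop⟩ : C(↥(ball ((0 : ℂ), y₀) r), ℂ))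
      (⟨fun p : ↥(ball ((0 : ℂ), y₀) r) ↦ c₀ * p.1.1, by fun_prop⟩ : C(↥(ball ((0 : ℂ), y₀) r), ℂ)) :=
    { toFun := fun tp ↦ C (γ tp) * tp.2.1.1
      continuous_toFun := by fun_prop
      map_zero_left := fun p ↦ by
        change C (γ (0, p)) * p.1.1 = C p * p.1.1
        rw [hγ0]
      map_one_left := fun p ↦ by
        change C (γ (1, p)) * p.1.1 = c₀ * p.1.1
        rw [hγ1] }
  have e₁ := relativeSingularHomology.map_eq_of_homotopic_holds R M hm hm₁ H₁ (fun tp htp h0 ↦ htp (by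
    change C (γ tp) * tp.2.1.1 ∈ ({0} : Set ℂ) at h0
    simp only [mem_singleton_iff, mul_eq_zero, hC, false_or] at h0
    exact h0)) n
  -- second homotopy: join `c₀` to `1` inside `ℂ ∖ 0`
  have hpc : IsPathConnected ({0}ᶜ : Set ℂ) :=
    isPathConnected_compl_singleton_of_one_lt_rank (by simp) 0
  obtain ⟨δ, hδ⟩ := (hpc.joinedIn c₀ hc₀ 1 one_ne_zero)
  let H₂ : ContinuousMap.Homotopy
      (⟨fun p : ↥(ball ((0 : ℂ), y₀) r) ↦ c₀ * p.1.1, by fun_prop⟩ : C(↥(ball ((0 : ℂ), y₀) r), ℂ))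
      (⟨fun p : ↥(ball ((0 : ℂ), y₀) r) ↦ p.1.1, by fun_prop⟩ : C(↥(ball ((0 : ℂ), y₀) r), ℂ)) :=
    { toFun := fun tp ↦ δ tp.1 * tp.2.1.1
      continuous_toFun := by fun_prop
      map_zero_left := fun p ↦ by
        change δ 0 * p.1.1 = c₀ * p.1.1
        rw [δ.source]
      map_one_left := fun p ↦ by
        change δ 1 * p.1.1 = p.1.1
        rw [δ.target, one_mul] }
  have e₂ := relativeSingularHomology.map_eq_of_homotopic_holds R M hm₁ hpr H₂ (fun tp htp h0 ↦ htp (by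
    change δ tp.1 * tp.2.1.1 ∈ ({0} : Set ℂ) at h0
    have hδt : δ tp.1 ≠ 0 := hδ tp.1
    simp only [mem_singleton_iff, mul_eq_zero, hδt, false_or] at h0
    exact h0)) n
  exact e₁.trans e₂

end PairMapModel


end Literature.AlgebraicTopology.SingularHomology

end
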